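import Summits.BirchSwinnertonDyer.Rank1Residual.GaloisImage.KolyvaginCoreGraphPair
import HarnessLib

/-!
# The core graph `X⁰` at `m = 1`: separated families of classes, and the lines `R_𝔮(d)`
# (cell `b2b-bsdres`, team n1011, row T-R1-56-G, file G3b; seat p11; skeleton
# `cells/n1011/skel/T-R1-56-G.md` §4.B)

HONEST FRAMING (verbatim for the cell): research route; prove what is provable now; no claim beyond
stated classes; nothing booked; no mark / label moved.  TOOL theorems, no definition, no named fact.

Two ingredients of the `m = 1` proof of Sakamoto's Lemma 6.3 (= Mazur–Rubin Prop. 4.3.10;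
`KolyvaginCoreGraphDescent.lean`):
* **separated classes are independent**: classes `y_i ∈ B` (`i ∈ T`) killed by the prime `p`, with
  homomorphisms `L_i` (localisations) such that `L_i y_i ≠ 0` and `L_i y_j = 0` (`i ≠ j`), force
  `p^{#T} ≤ #B` (elementary; the counting behind "`ν(d) ≥ λ^*(1)`"-type arguments);
* **the lines `R_𝔮(d) := H¹_{(𝓕_𝔮(d))^*}(K, M^D)`** for a core vertex `d` and a Kolyvagin prime `𝔮` at
  which `H(d)` dies: `#R_𝔮(d) = p` (pair counting against `𝓕_𝔮(d)`, Rubin Prop. 2.6.1 (3)), its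
  non-zero classes are non-zero at `𝔮` (else they would lie in `H^*(d) = 0`), and `𝓕_𝔮(d𝔮) = 𝓕_𝔮(d)`.

References: [Sakamoto2024] §6, Lemma 6.1, Lemma 6.3 (pp. 930–931); [Rubin2011] Prop. 2.6.1 (p. 22);
B. Mazur, K. Rubin, Mem. AMS 799 (2004) §4.3 (not held).
-/

noncomputable section

open scoped Classical NumberField ContRepresentation
open Function NumberField IsDedekindDomain
open Literature.NumberTheory.GaloisRepresentations Literature.NumberTheory.GaloisRepresentations.DiscreteGaloisModule
  Literature.NumberTheory.GaloisCohomology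
open Summit.BirchSwinnertonDyer.Rank1Residual.GaloisImage.CoreRankZero
open Summit.BirchSwinnertonDyer.Rank1Residual.X11b.Levels

universe u

namespace Summit.BirchSwinnertonDyer.Rank1Residual.GaloisImage.CoreRankOne

variable {K : Type u} [Field K] [NumberField K]
variable {M : Type u} [AddCommGroup M] [TopologicalSpace M] [DiscreteTopology M] [Finite M]
variable {ρ : DiscreteGaloisModule K M}

/-! ## §12. Separated families of classes; the lines `R_𝔮(d)` -/

/-- **Separated classes are independent**: if `y_i ∈ B` (`i ∈ T`) are killed by the prime `p`,
`L_i (y_i) ≠ 0` and `L_i (y_j) = 0` for `i ≠ j` (homomorphisms `L_i` — localisations), then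
`p^{#T} ≤ #B` (induction on `T`: `B ⊇ (B ∩ ker L_i) + ℤ y_i`, a sum with trivial intersection).
[folklore] -/
theorem pow_card_le_natCard_of_separated {G : Type*} [AddCommGroup G] {ι : Type*} {X : ι → Type*}
    [∀ i, AddCommGroup (X i)] (L : ∀ i, G →+ X i) {p : ℕ} (hp : p.Prime) (y : ι → G)
    (T : Finset ι) (hpy : ∀ i ∈ T, p • y i = 0) (hsep : ∀ i ∈ T, ∀ j ∈ T, i ≠ j → L i (y j) = 0)
    (hne : ∀ i ∈ T, L i (y i) ≠ 0) (B : AddSubgroup G) [Finite B] (hB : ∀ i ∈ T, y i ∈ B) :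
    p ^ T.card ≤ Nat.card B := by
  classical
  haveI : Fact p.Prime := ⟨hp⟩
  induction T using Finset.induction_on generalizing B with
  | empty => rw [Finset.card_empty, pow_zero]; exact Nat.card_pos
  | insert i T hiT ih =>
    -- `B' = B ∩ ker L_i` contains the other `y_j`
    let B' : AddSubgroup G := B ⊓ (L i).ker
    haveI : Finite B' := Finite.of_injective (AddSubgroup.inclusion (inf_le_left : B' ≤ B))
      (AddSubgroup.inclusion_injective _)
    have hB' : ∀ j ∈ T, y j ∈ B' := fun j hj =>
      ⟨hB j (Finset.mem_insert_of_mem hj), (AddMonoidHom.mem_ker).2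
        (hsep i (Finset.mem_insert_self i T) j (Finset.mem_insert_of_mem hj)
          (fun h => hiT (h ▸ hj)))⟩
    have hIH := ih (fun j hj => hpy j (Finset.mem_insert_of_mem hj))
      (fun j hj k hk => hsep j (Finset.mem_insert_of_mem hj) k (Finset.mem_insert_of_mem hk))
      (fun j hj => hne j (Finset.mem_insert_of_mem hj)) B' hB'
    -- `y_i` has order `p`
    have hyi0 : y i ≠ 0 := fun h => hne i (Finset.mem_insert_self i T) (by rw [h, map_zero])
    have hord : addOrderOf (y i) = p :=
      addOrderOf_eq_prime (hpy i (Finset.mem_insert_self i T)) hyi0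
    have hZ : Nat.card (AddSubgroup.zmultiples (y i)) = p := by rw [Nat.card_zmultiples, hord]
    -- `(b, z) ↦ b + z : B' × ℤy_i → B` is injective
    have hyB : AddSubgroup.zmultiples (y i) ≤ B :=
      (AddSubgroup.zmultiples_le).2 (hB i (Finset.mem_insert_self i T))
    let f : B' × AddSubgroup.zmultiples (y i) → B := fun bz =>
      ⟨(bz.1 : G) + (bz.2 : G), add_mem (inf_le_left (b := (L i).ker) bz.1.2) (hyB bz.2.2)⟩
    have hf : Function.Injective f := by
      rintro ⟨⟨b, hb⟩, ⟨z, hz⟩⟩ ⟨⟨b', hb'⟩, ⟨z', hz'⟩⟩ h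
      have h1 : b + z = b' + z' := congrArg Subtype.val h
      -- `z - z' ∈ ℤy_i ∩ ker L_i = 0`
      obtain ⟨k, rfl⟩ := AddSubgroup.mem_zmultiples_iff.1 hz
      obtain ⟨k', rfl⟩ := AddSubgroup.mem_zmultiples_iff.1 hz'
      have h2' : k • y i + b = b' + k' • y i := by rw [add_comm]; exact h1
      have h2 : (k - k') • y i = b' - b := by
        rw [sub_smul]
        exact sub_eq_sub_iff_add_eq_add.2 h2'
      have h3 : L i ((k - k') • y i) = 0 := by
        rw [h2, map_sub, (AddMonoidHom.mem_ker).1 hb'.2, (AddMonoidHom.mem_ker).1 hb.2, sub_zero]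
      rw [map_zsmul] at h3
      have hordL : addOrderOf (L i (y i)) = p :=
        addOrderOf_eq_prime (by rw [← map_nsmul, hpy i (Finset.mem_insert_self i T), map_zero])
          (hne i (Finset.mem_insert_self i T))
      have hdvd : (p : ℤ) ∣ (k - k') := by
        rw [← hordL]; exact (addOrderOf_dvd_iff_zsmul_eq_zero).2 h3
      have hz0 : (k - k') • y i = 0 := by
        obtain ⟨m, hm⟩ := hdvd
        rw [hm, mul_comm, mul_zsmul, natCast_zsmul, hpy i (Finset.mem_insert_self i T), zsmul_zero]
      have hkk : k • y i = k' • y i := by rw [← sub_eq_zero, ← sub_smul, hz0]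
      have hbb : b = b' := by rw [hkk] at h1; exact add_right_cancel h1
      subst hbb
      simp only [hkk]
    have hcard := Nat.card_le_card_of_injective f hf
    rw [Nat.card_prod, hZ] at hcard
    rw [Finset.card_insert_of_notMem hiT, pow_succ]
    exact (Nat.mul_le_mul_right p hIH).trans hcard

omit [Finite M] in
/-- `(𝓕(n𝔮))_𝔮 = (𝓕(n))_𝔮`: making the level structures strict at `𝔮` forgets whether `𝔮` was in the
level (Rubin Prop. 2.6.1: `H¹_{𝓕_ℓ(n)}` is the common subgroup of `H¹_{𝓕(n)}` and `H¹_{𝓕(nℓ)}`).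
[cite: Rubin2011, Prop. 2.6.1 (p. 22)] -/
theorem strictAt_atLevel_insert_eq (D : KolyvaginDatum ρ) (𝓕 : SelmerStructure ρ)
    (n : Finset (HeightOneSpectrum (𝓞 K))) (q : HeightOneSpectrum (𝓞 K)) :
    (D.atLevel 𝓕 (insert q n)).strictAt {q} = (D.atLevel 𝓕 n).strictAt {q} := by
  funext v
  by_cases hv : v = Sum.inr q
  · subst hv; rw [Level.strictAt_inr_self, Level.strictAt_inr_self]
  · rw [Level.strictAt_apply_of_ne _ q hv, Level.strictAt_apply_of_ne _ q hv,
      Level.atLevel_insert_apply_of_ne D 𝓕 q hv]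

/-- **The line `R_𝔮(d) = H¹_{(𝓕_𝔮(d))^*}(K, M^D)` has order `p`** when `d` is a core vertex and `H(d)`
dies at the Kolyvagin prime `𝔮` (pair counting against `𝓕_𝔮(d)`: `#H(d)·#R_𝔮(d) = #H(d)·#H^*(d)·p`).
[cite: Sakamoto2024, Lemma 6.1 and §6 (pp. 930–931)] [cite: Rubin2011, Prop. 2.6.1 (3) (p. 22)] -/
theorem natCard_dual_strictAt_of_core {p : ℕ} [Fact p.Prime] {inv : LocalInvariants K p}
    (hperf : inv.IsPerfect) (hsum : inv.SumLocalTermEqZero) (hcompl : inv.SelmerComplement)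
    (hM : ∀ m : M, p • m = 0) {S : Finset (Place K)}
    (hS : ∀ v : HeightOneSpectrum (𝓞 K), (Sum.inr v : Place K) ∉ S →
      ((p : ℕ) : 𝓞 K) ∉ v.asIdeal ∧ GaloisRep.IsUnramifiedAt v ρ)
    {𝓕 : SelmerStructure ρ} (h𝓕 : 𝓕.IsUnramifiedOutside S)
    (hfin : Finite 𝓕.selmerGroup) (hfind : Finite (inv.dualSelmerStructure ρ 𝓕).selmerGroup)
    (hχ : LocalInvariants.HasCoreRank inv 𝓕 p 1)
    {D : KolyvaginDatum ρ} (hPS : ∀ q ∈ D.primes, (Sum.inr q : Place K) ∉ S)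
    (hU : ∀ q ∈ D.primes, Nat.card (unramifiedSubgroup (GaloisRep.toLocal q ρ) 1) = p)
    (hT : ∀ q ∈ D.primes, Nat.card (D.transverse (Sum.inr q)) = p)
    {d : Finset (HeightOneSpectrum (𝓞 K))} (hd : D.IsLevel d)
    (hcore : (inv.dualSelmerStructure ρ (D.atLevel 𝓕 d)).selmerGroup = ⊥)
    {q : HeightOneSpectrum (𝓞 K)} (hq : q ∈ D.primes)
    (h0 : ∀ x ∈ (D.atLevel 𝓕 d).selmerGroup, galoisCohomology.localization ρ (Sum.inr q) 1 x = 0) :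
    Nat.card (inv.dualSelmerStructure ρ ((D.atLevel 𝓕 d).strictAt {q})).selmerGroup = p := by
  have hp : p.Prime := Fact.out
  have hcardd := natCard_selmerGroup_atLevel_of_core hperf hsum hcompl hM hS h𝓕 hfin hfind hχ hPS hU hT
    hd hcore
  have hW : ((D.atLevel 𝓕 d).strictAt {q}).selmerGroup = (D.atLevel 𝓕 d).selmerGroup := by
    ext x
    rw [mem_selmerGroup_strictAt_iff]
    exact ⟨fun h => h.1, fun h => ⟨h, h0 x h⟩⟩
  have hloc : Nat.card (D.atLevel 𝓕 d (Sum.inr q)) = p := by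
    by_cases hqd : q ∈ d
    · rw [Level.atLevel_inr_of_mem D 𝓕 hqd]; exact hT q hq
    · rw [Level.atLevel_inr_of_not_mem D 𝓕 hqd, h𝓕.2 q (hPS q hq)]; exact hU q hq
  have P := natCard_mul_natCard_dual_strictAt hperf hsum hcompl hM (places_cond_union hS (insert q d))
    (isUnramifiedOutside_atLevel_union h𝓕 D (Finset.subset_insert q d)) q
    (inr_mem_union S (Finset.mem_insert_self q d))
  rw [hW, hcore, AddSubgroup.card_bot, mul_one, hcardd, hloc] at P
  exact mul_left_cancel₀ hp.ne_zero P

/-- A non-zero class of `R_𝔮(d)` is non-zero at `𝔮` when `d` is a core vertex (otherwise it would lie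
in `H^*(d) = 0`). [cite: Sakamoto2024, §6 (p. 931)] -/
theorem localization_ne_zero_of_mem_dual_strictAt_of_core {n : ℕ} (inv : LocalInvariants K n)
    {D : KolyvaginDatum ρ} {𝓕 : SelmerStructure ρ} {d : Finset (HeightOneSpectrum (𝓞 K))}
    (hcore : (inv.dualSelmerStructure ρ (D.atLevel 𝓕 d)).selmerGroup = ⊥) {q : HeightOneSpectrum (𝓞 K)}
    {y : galoisCohomology (ρ.tateDual n) 1}
    (hy : y ∈ (inv.dualSelmerStructure ρ ((D.atLevel 𝓕 d).strictAt {q})).selmerGroup) (hy0 : y ≠ 0) :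
    galoisCohomology.localization (ρ.tateDual n) (Sum.inr q) 1 y ≠ 0 := fun h =>
  hy0 ((AddSubgroup.mem_bot).1 (hcore ▸ mem_dualSelmerGroup_of_mem_strictAt inv _ q hy
    (by rw [h]; exact zero_mem _)))

end Summit.BirchSwinnertonDyer.Rank1Residual.GaloisImage.CoreRankOne

end
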